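import Summits.HubbardSuperconductivity.HubbardSuperconductivity.Theses.CooperSharpness

/-!
# Route `CooperSharpness` — assembly item `Assembly` (stmt-HubbardSuperconductivity-12855)

`CooperCoordinateGrowth → GrowthGlue → FloorGivesLRO → HubbardSuperconductivity`: pure logic,
the route file's certified deciding theorem `closes` read as an implication.

Sources: D. J. Scalapino, Phys. Rep. 250 (1995) 329; D. P. Arovas, E. Berg, S. A. Kivelson,
S. Raghu, Annu. Rev. Condens. Matter Phys. 13 (2022) 239. No new definitions.
-/

-- the mandated namespace `Summit.<Summit>.<Problem>.Theorems` repeats `HubbardSuperconductivity`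
-- (single-problem summit, D-0017), which the `dupNamespace` linter flags on every declaration
set_option linter.dupNamespace false

namespace Summit.HubbardSuperconductivity.HubbardSuperconductivity.Theorems.CooperSharpness

open Summit.HubbardSuperconductivity.HubbardSuperconductivity.Theses.CooperSharpness

/-- **`Assembly`** (stmt-HubbardSuperconductivity-12855): the growth law, the telescoping glue
and the `liminf` bookkeeping give the summit statement — the deciding theorem `closes` of the
route file. [folklore] -/
theorem assembly_proof :
    Summit.HubbardSuperconductivity.HubbardSuperconductivity.Theses.CooperSharpness.Assembly :=
  fun h₁ h₂ h₃ => closes h₁ h₂ h₃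

end Summit.HubbardSuperconductivity.HubbardSuperconductivity.Theorems.CooperSharpness
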